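import Summits.HodgeConjecture.HodgeConjecture.Theorems.HodgeLocusCensusPlaneRank
import Summits.HodgeConjecture.HodgeConjecture.Theorems.HodgeLocusCensusPlaneRank6
import Summits.HodgeConjecture.HodgeConjecture.Theorems.HodgeLocusCensusPlaneRank8
import HarnessLib

/-!
# HodgeLocusCensusPlaneSumCert — the PLANE-SUM CORE mechanism: a computable model of ℤ[ζ₈], the core periods of a signed sum of coordinate planes, and kernel-checkable rank certificates (cell pub-hlocus, LEAD gen 5, (T36))
HONEST FRAMING: certified instances and evidence bearing on the general Hodge conjecture; no claim.

Every census class of the Fermat quartic n-fold (n = 4, 6, 8) typed in `HodgeLocusCensusTwistCells` / `HodgeLocusCensusGrassmannianCells` is a signed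
sum δ = Σ_P c_P [P] of coordinate planes P = `plane44 a₁ a₃ a₅` (`plane64 a₁ a₃ a₅ 0`, `plane84 a₁ a₃ a₅ 0 0`): twists only in the three HEAD pairs,
tails untwisted. By the closed form of the schema period (`period_plane44/64/84`) the entry (i, j) of Movasati's matrix is
  [every pair sum of i + j is 2] · ζ^{tail(i) + tail(j)} · C(i₀+j₀, i₂+j₂, i₄+j₄),   C(a,b,e) = Σ_P c_P ζ^{(a+1)(1+2a₁)+(b+1)(1+2a₃)+(e+1)(1+2a₅)} ∈ ℤ[ζ₈]
(`periodComb_planeList4/6/8`, the CORE `core`). Hence the matrix is block diagonal in the pair-sum type of the row, and the block of a type with head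
shape s = (s₀,s₁,s₂) ∈ {0,1,2}³ is, up to nonzero row/column scalings and duplications, the CORE MATRIX C_s = [C(h + g)], h ∈ ∏[0,s_e],
g ∈ ∏[0,2−s_e]; so rank M_δ(X⁴_n) = Σ_types rank C_{shape} — one finite computation in ℤ[ζ₈] per class, valid for all n at once.
This file makes that computation KERNEL-CHECKABLE: `Z8` is ℤ[x]/(x⁴+1) on integer quadruples with `Z8.eval ζ` into any field with ζ⁴ = −1
(`eval_add`, `eval_mul`, `eval_mono`, …); a `CoreCert` lists, per shape, the rank r_s, ordered pivot rows/columns and INTEGRAL factors A_s (|box s| × r_s),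
B_s (r_s × |box (2−s)|) with Σ_ℓ A_s[h,ℓ] B_s[ℓ,g] = C(h+g), A_s lower-triangular and B_s upper-triangular on the pivots with pivots certified nonzero
(positive integers, resp. a norm cofactor w with B·w a positive integer) — the decidable predicate `CoreCert.Valid`, decided by `decide +kernel` in the
class files; and `sum_modes` re-indexes a sum over the modes of one type (modes = (type, ℓ < r_shape), enumerated type-major from offsets). The per-n
files `HodgeLocusCensusPlaneSumRank4/6/8` turn a valid certificate into M = U·V through K^r (rank ≤ r) and an r × r minor = (lower △) · (upper △) with
nonzero diagonal (rank ≥ r). Numbers of record reproduced by the certificates (gen_cert.py, exact; = engines A/B/R of the census): [Z] 11/36/83,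
[Z]−[Π] 12/39/89, [Z]+[Π] 13/42/95, [Z]±[Z′] 11/36/83, [Z]±[Π′] 16/53/119, [Π] 6/19/45 for n = 4/6/8.
-/

namespace Summit.HodgeConjecture.HodgeConjecture.HodgeLocus.Census.PlaneSum

open TwistCells GrSection

/-! ## ℤ[ζ₈] as integer quadruples -/

/-- ℤ[x]/(x⁴ + 1): c₀ + c₁x + c₂x² + c₃x³. -/
structure Z8 where
  c0 : ℤ
  c1 : ℤ
  c2 : ℤ
  c3 : ℤ
deriving DecidableEq

namespace Z8

/-- addition. -/
def add (x y : Z8) : Z8 := ⟨x.c0 + y.c0, x.c1 + y.c1, x.c2 + y.c2, x.c3 + y.c3⟩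
/-- multiplication modulo x⁴ = −1. -/
def mul (x y : Z8) : Z8 :=
  ⟨x.c0 * y.c0 - x.c1 * y.c3 - x.c2 * y.c2 - x.c3 * y.c1, x.c0 * y.c1 + x.c1 * y.c0 - x.c2 * y.c3 - x.c3 * y.c2,
   x.c0 * y.c2 + x.c1 * y.c1 + x.c2 * y.c0 - x.c3 * y.c3, x.c0 * y.c3 + x.c1 * y.c2 + x.c2 * y.c1 + x.c3 * y.c0⟩
/-- 0. -/
instance : Zero Z8 := ⟨⟨0, 0, 0, 0⟩⟩
/-- +. -/
instance : Add Z8 := ⟨add⟩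
/-- ·. -/
instance : Mul Z8 := ⟨mul⟩
/-- unfolding 0. -/
theorem zero_def : (0 : Z8) = ⟨0, 0, 0, 0⟩ := rfl
/-- unfolding +. -/
theorem add_def (x y : Z8) : x + y = add x y := rfl
/-- unfolding ·. -/
theorem mul_def (x y : Z8) : x * y = mul x y := rfl
/-- integer multiple. -/
def smul (c : ℤ) (x : Z8) : Z8 := ⟨c * x.c0, c * x.c1, c * x.c2, c * x.c3⟩
/-- the monomial x^k reduced with x⁴ = −1, x⁸ = 1. -/
def mono (k : ℕ) : Z8 :=
  if k % 8 = 0 then ⟨1, 0, 0, 0⟩ else if k % 8 = 1 then ⟨0, 1, 0, 0⟩ else if k % 8 = 2 then ⟨0, 0, 1, 0⟩ else if k % 8 = 3 then ⟨0, 0, 0, 1⟩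
  else if k % 8 = 4 then ⟨-1, 0, 0, 0⟩ else if k % 8 = 5 then ⟨0, -1, 0, 0⟩ else if k % 8 = 6 then ⟨0, 0, -1, 0⟩ else ⟨0, 0, 0, -1⟩
/-- Σ_{ℓ < n} f ℓ. -/
def rsum : ℕ → (ℕ → Z8) → Z8
  | 0, _ => 0
  | n + 1, f => rsum n f + f n
/-- "is a positive rational integer" (Boolean test). -/
def isPosConst (x : Z8) : Bool := decide (0 < x.c0) && decide (x.c1 = 0) && decide (x.c2 = 0) && decide (x.c3 = 0)
/-- bounded `all`: p 0 ∧ … ∧ p (n−1) (structural, for kernel evaluation). -/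
def allLT : ℕ → (ℕ → Bool) → Bool
  | 0, _ => true
  | n + 1, p => allLT n p && p n
/-- `allLT` is the bounded ∀. -/
theorem allLT_iff (n : ℕ) (p : ℕ → Bool) : allLT n p = true ↔ ∀ k < n, p k = true := by
  induction n with
  | zero => simp [allLT]
  | succ n ih =>
    rw [allLT, Bool.and_eq_true, ih]
    constructor
    · rintro ⟨h, hn⟩ k hk
      rcases Nat.lt_succ_iff_lt_or_eq.mp hk with hk | rfl
      · exact h k hk
      · exact hn
    · intro h
      exact ⟨fun k hk => h k (Nat.lt_succ_of_lt hk), h n (Nat.lt_succ_self n)⟩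

/-- evaluation at ζ. -/
def eval {K : Type*} [CommRing K] (ζ : K) (x : Z8) : K := (x.c0 : K) + (x.c1 : K) * ζ + (x.c2 : K) * ζ ^ 2 + (x.c3 : K) * ζ ^ 3

variable {K : Type*} [CommRing K] (ζ : K)

/-- eval 0 = 0. -/
theorem eval_zero : eval ζ (⟨0, 0, 0, 0⟩ : Z8) = 0 := by simp [eval]
/-- eval is additive. -/
theorem eval_add (x y : Z8) : eval ζ (x + y) = eval ζ x + eval ζ y := by
  simp only [eval, add_def, add]
  push_cast
  ring
/-- eval commutes with integer multiples. -/
theorem eval_smul (c : ℤ) (x : Z8) : eval ζ (smul c x) = (c : K) * eval ζ x := by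
  simp only [eval, smul]
  push_cast
  ring
/-- multiplicativity needs ζ⁴ = −1. -/
theorem eval_mul (h4 : ζ ^ 4 = -1) (x y : Z8) : eval ζ (x * y) = eval ζ x * eval ζ y := by
  simp only [eval, mul_def, mul]
  push_cast
  linear_combination (-((x.c1 : K) * y.c3 + x.c2 * y.c2 + x.c3 * y.c1) - (x.c2 * y.c3 + x.c3 * y.c2) * ζ - x.c3 * y.c3 * ζ ^ 2) * h4
/-- eval of the monomial x^k is ζ^k (ζ⁴ = −1). -/
theorem eval_mono (h4 : ζ ^ 4 = -1) (k : ℕ) : eval ζ (mono k) = ζ ^ k := by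
  have h8 : ζ ^ 8 = 1 := by linear_combination (ζ ^ 4 - 1) * h4
  have h5 : ζ ^ 5 = -ζ := by linear_combination ζ * h4
  have h6 : ζ ^ 6 = -ζ ^ 2 := by linear_combination ζ ^ 2 * h4
  have h7 : ζ ^ 7 = -ζ ^ 3 := by linear_combination ζ ^ 3 * h4
  rw [show ζ ^ k = ζ ^ (k % 8) by
    conv_lhs => rw [← Nat.div_add_mod k 8]
    rw [pow_add, pow_mul, h8, one_pow, one_mul]]
  unfold mono
  have hk : k % 8 < 8 := Nat.mod_lt _ (by norm_num)
  generalize k % 8 = q at *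
  interval_cases q <;> simp [eval, h4, h5, h6, h7]
/-- eval of a bounded sum. -/
theorem eval_rsum (n : ℕ) (f : ℕ → Z8) : eval ζ (rsum n f) = ∑ ℓ ∈ Finset.range n, eval ζ (f ℓ) := by
  induction n with
  | zero => simp [rsum, zero_def, eval_zero]
  | succ n ih => rw [rsum, eval_add, ih, Finset.sum_range_succ]
/-- unfolding `isPosConst`. -/
theorem isPosConst_iff (x : Z8) : x.isPosConst = true ↔ 0 < x.c0 ∧ x.c1 = 0 ∧ x.c2 = 0 ∧ x.c3 = 0 := by
  simp [isPosConst, and_assoc]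
/-- a positive integer constant evaluates to itself … -/
theorem eval_posConst {x : Z8} (h : x.isPosConst = true) : eval ζ x = (x.c0 : K) := by
  obtain ⟨_, h1, h2, h3⟩ := (isPosConst_iff x).mp h
  simp [eval, h1, h2, h3]
/-- … hence is nonzero in characteristic 0. -/
theorem eval_ne_zero_of_posConst {F : Type*} [Field F] [CharZero F] (ζ : F) {x : Z8} (h : x.isPosConst = true) : eval ζ x ≠ 0 := by
  rw [eval_posConst ζ h]
  exact_mod_cast ((isPosConst_iff x).mp h).1.ne'

end Z8

/-! ## The core of a signed plane sum -/

/-- C(a,b,e) = Σ_P c_P ζ^{(a+1)(1+2a₁)+(b+1)(1+2a₃)+(e+1)(1+2a₅)} for the class L = [(c_P, a₁, a₃, a₅)]. -/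
def core : List (ℤ × ℕ × ℕ × ℕ) → ℕ → ℕ → ℕ → Z8
  | [], _, _, _ => 0
  | p :: L, a, b, e => Z8.smul p.1 (Z8.mono ((a + 1) * (1 + 2 * p.2.1) + (b + 1) * (1 + 2 * p.2.2.1) + (e + 1) * (1 + 2 * p.2.2.2))) + core L a b e

variable {K : Type*} [Field K] (ζ : K)

/-- eval of the core is the signed sum of the plane periods' head factors. -/
theorem eval_core (h4 : ζ ^ 4 = -1) (L : List (ℤ × ℕ × ℕ × ℕ)) (a b e : ℕ) : Z8.eval ζ (core L a b e) =
    (L.map fun p => (p.1 : K) * ζ ^ ((a + 1) * (1 + 2 * p.2.1) + (b + 1) * (1 + 2 * p.2.2.1) + (e + 1) * (1 + 2 * p.2.2.2))).sum := by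
  induction L with
  | nil => simp [core, Z8.zero_def, Z8.eval_zero]
  | cons p L ih => rw [core, Z8.eval_add, Z8.eval_smul, Z8.eval_mono ζ h4, ih, List.map_cons, List.sum_cons]

/-- the class as a census δ on X⁴₄ … -/
def planeList4 (L : List (ℤ × ℕ × ℕ × ℕ)) : List (ℚ × LinearCycle 4) := L.map fun p => ((p.1 : ℚ), plane44 p.2.1 p.2.2.1 p.2.2.2)
/-- … on X⁴₆ (tail untwisted) … -/
def planeList6 (L : List (ℤ × ℕ × ℕ × ℕ)) : List (ℚ × LinearCycle 6) := L.map fun p => ((p.1 : ℚ), plane64 p.2.1 p.2.2.1 p.2.2.2 0)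
/-- … on X⁴₈ (tails untwisted). -/
def planeList8 (L : List (ℤ × ℕ × ℕ × ℕ)) : List (ℚ × LinearCycle 8) := L.map fun p => ((p.1 : ℚ), plane84 p.2.1 p.2.2.1 p.2.2.2 0 0)

/-- ENTRY FORMULA on X⁴₄ (ζ⁴ = −1): p_i(δ) = [pair sums 2] · C(i₀, i₂, i₄)(ζ). -/
theorem periodComb_planeList4 (h4 : ζ ^ 4 = -1) (L : List (ℤ × ℕ × ℕ × ℕ)) (i : Fin 6 → ℕ) :
    periodComb 4 4 ζ (planeList4 L) i = if i 0 + i 1 = 2 ∧ i 2 + i 3 = 2 ∧ i 4 + i 5 = 2 then Z8.eval ζ (core L (i 0) (i 2) (i 4)) else 0 := by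
  induction L with
  | nil => simp [periodComb, planeList4, core, Z8.zero_def, Z8.eval_zero]
  | cons p L ih =>
    have hc : periodComb 4 4 ζ (planeList4 (p :: L)) i = ((p.1 : ℚ) : K) * period 4 4 ζ (plane44 p.2.1 p.2.2.1 p.2.2.2) i +
        periodComb 4 4 ζ (planeList4 L) i := by
      simp [periodComb, planeList4]
    rw [hc, ih, period_plane44, core, Z8.eval_add, Z8.eval_smul, Z8.eval_mono ζ h4, Rat.cast_intCast]
    split_ifs <;> ring

/-- ENTRY FORMULA on X⁴₆: p_i(δ) = [pair sums 2] · ζ^{i₆+1} · C(i₀, i₂, i₄)(ζ). -/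
theorem periodComb_planeList6 (h4 : ζ ^ 4 = -1) (L : List (ℤ × ℕ × ℕ × ℕ)) (i : Fin 8 → ℕ) :
    periodComb 6 4 ζ (planeList6 L) i =
      if i 0 + i 1 = 2 ∧ i 2 + i 3 = 2 ∧ i 4 + i 5 = 2 ∧ i 6 + i 7 = 2 then ζ ^ (i 6 + 1) * Z8.eval ζ (core L (i 0) (i 2) (i 4)) else 0 := by
  induction L with
  | nil => simp [periodComb, planeList6, core, Z8.zero_def, Z8.eval_zero]
  | cons p L ih =>
    have hc : periodComb 6 4 ζ (planeList6 (p :: L)) i = ((p.1 : ℚ) : K) * period 6 4 ζ (plane64 p.2.1 p.2.2.1 p.2.2.2 0) i +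
        periodComb 6 4 ζ (planeList6 L) i := by
      simp [periodComb, planeList6]
    rw [hc, ih, period_plane64, core, Z8.eval_add, Z8.eval_smul, Z8.eval_mono ζ h4, Rat.cast_intCast]
    split_ifs <;> ring

/-- ENTRY FORMULA on X⁴₈: p_i(δ) = [pair sums 2] · ζ^{(i₆+1)+(i₈+1)} · C(i₀, i₂, i₄)(ζ). -/
theorem periodComb_planeList8 (h4 : ζ ^ 4 = -1) (L : List (ℤ × ℕ × ℕ × ℕ)) (i : Fin 10 → ℕ) :
    periodComb 8 4 ζ (planeList8 L) i =
      if i 0 + i 1 = 2 ∧ i 2 + i 3 = 2 ∧ i 4 + i 5 = 2 ∧ i 6 + i 7 = 2 ∧ i 8 + i 9 = 2 then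
        ζ ^ (i 6 + 1 + (i 8 + 1)) * Z8.eval ζ (core L (i 0) (i 2) (i 4)) else 0 := by
  induction L with
  | nil => simp [periodComb, planeList8, core, Z8.zero_def, Z8.eval_zero]
  | cons p L ih =>
    have hc : periodComb 8 4 ζ (planeList8 (p :: L)) i = ((p.1 : ℚ) : K) * period 8 4 ζ (plane84 p.2.1 p.2.2.1 p.2.2.2 0 0) i +
        periodComb 8 4 ζ (planeList8 L) i := by
      simp [periodComb, planeList8]
    rw [hc, ih, PlaneRank8.period_plane84, core, Z8.eval_add, Z8.eval_smul, Z8.eval_mono ζ h4, Rat.cast_intCast]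
    split_ifs <;> ring

/-! ## Core certificates -/

/-- total list lookup with default. -/
def lget {α : Type*} (d : α) : List α → ℕ → α
  | [], _ => d
  | a :: _, 0 => a
  | _ :: l, n + 1 => lget d l n

/-- per shape s ∈ {0,1,2}³ (position 9s₀+3s₁+s₂): the rank r_s of the core matrix, r_s ordered pivot rows h ∈ ∏[0,s_e] and columns g ∈ ∏[0,2−s_e],
the factor A_s (rows h in lexicographic order, r_s columns), the factor B_s (r_s rows, columns g in lexicographic order) and the r_s norm cofactors of
the B-pivots — all in ℤ[ζ₈]. -/
structure CoreCert where
  rsh : List ℕ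
  pr : List (List (ℕ × ℕ × ℕ))
  pc : List (List (ℕ × ℕ × ℕ))
  tA : List (List (List Z8))
  tB : List (List (List Z8))
  tw : List (List Z8)

namespace CoreCert

variable (Ψ : CoreCert)

/-- rank of the shape. -/
def rs (s0 s1 s2 : ℕ) : ℕ := lget 0 Ψ.rsh (9 * s0 + 3 * s1 + s2)
/-- the ℓ-th pivot row (a head triple h ≤ s) … -/
def rowP (s0 s1 s2 ℓ : ℕ) : ℕ × ℕ × ℕ := lget (0, 0, 0) (lget [] Ψ.pr (9 * s0 + 3 * s1 + s2)) ℓ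
/-- … and pivot column (a head triple g ≤ 2 − s). -/
def colP (s0 s1 s2 ℓ : ℕ) : ℕ × ℕ × ℕ := lget (0, 0, 0) (lget [] Ψ.pc (9 * s0 + 3 * s1 + s2)) ℓ
/-- A_s[(a,b,e), ℓ]. -/
def A (s0 s1 s2 a b e ℓ : ℕ) : Z8 := lget 0 (lget [] (lget [] Ψ.tA (9 * s0 + 3 * s1 + s2)) (a * ((s1 + 1) * (s2 + 1)) + b * (s2 + 1) + e)) ℓ
/-- B_s[ℓ, (a,b,e)]. -/
def B (s0 s1 s2 ℓ a b e : ℕ) : Z8 := lget 0 (lget [] (lget [] Ψ.tB (9 * s0 + 3 * s1 + s2)) ℓ) (a * ((3 - s1) * (3 - s2)) + b * (3 - s2) + e)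
/-- the norm cofactor of the ℓ-th B-pivot. -/
def w (s0 s1 s2 ℓ : ℕ) : Z8 := lget 0 (lget [] Ψ.tw (9 * s0 + 3 * s1 + s2)) ℓ

/-- (F) factorisation Σ_{ℓ<r_s} A_s[h,ℓ] B_s[ℓ,g] = C(h+g) on every shape s and every head pair (h ≤ s, g ≤ 2 − s). -/
def validF (L : List (ℤ × ℕ × ℕ × ℕ)) : Bool :=
  Z8.allLT 3 fun s0 => Z8.allLT 3 fun s1 => Z8.allLT 3 fun s2 =>
    Z8.allLT (s0 + 1) fun a => Z8.allLT (s1 + 1) fun b => Z8.allLT (s2 + 1) fun e =>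
      Z8.allLT (3 - s0) fun a' => Z8.allLT (3 - s1) fun b' => Z8.allLT (3 - s2) fun e' =>
        decide (Z8.rsum (Ψ.rs s0 s1 s2) (fun ℓ => Ψ.A s0 s1 s2 a b e ℓ * Ψ.B s0 s1 s2 ℓ a' b' e') = core L (a + a') (b + b') (e + e'))
/-- (T) triangularity on the pivots: A_s[h_{ℓ₀}, ℓ] = 0 and B_s[ℓ, g_{ℓ₀}] = 0 for ℓ₀ < ℓ. -/
def validT : Bool :=
  Z8.allLT 3 fun s0 => Z8.allLT 3 fun s1 => Z8.allLT 3 fun s2 =>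
    Z8.allLT (Ψ.rs s0 s1 s2) fun ℓ₀ => Z8.allLT (Ψ.rs s0 s1 s2) fun ℓ => decide (ℓ ≤ ℓ₀) ||
      (decide (Ψ.A s0 s1 s2 (Ψ.rowP s0 s1 s2 ℓ₀).1 (Ψ.rowP s0 s1 s2 ℓ₀).2.1 (Ψ.rowP s0 s1 s2 ℓ₀).2.2 ℓ = 0) &&
       decide (Ψ.B s0 s1 s2 ℓ (Ψ.colP s0 s1 s2 ℓ₀).1 (Ψ.colP s0 s1 s2 ℓ₀).2.1 (Ψ.colP s0 s1 s2 ℓ₀).2.2 = 0))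
/-- (P) pivots: A_s[h_ℓ, ℓ] is a positive integer, B_s[ℓ, g_ℓ] · w_ℓ is a positive integer, and the pivot triples lie in their boxes. -/
def validP : Bool :=
  Z8.allLT 3 fun s0 => Z8.allLT 3 fun s1 => Z8.allLT 3 fun s2 => Z8.allLT (Ψ.rs s0 s1 s2) fun ℓ =>
    (Ψ.A s0 s1 s2 (Ψ.rowP s0 s1 s2 ℓ).1 (Ψ.rowP s0 s1 s2 ℓ).2.1 (Ψ.rowP s0 s1 s2 ℓ).2.2 ℓ).isPosConst &&
    (Ψ.B s0 s1 s2 ℓ (Ψ.colP s0 s1 s2 ℓ).1 (Ψ.colP s0 s1 s2 ℓ).2.1 (Ψ.colP s0 s1 s2 ℓ).2.2 * Ψ.w s0 s1 s2 ℓ).isPosConst &&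
    decide ((Ψ.rowP s0 s1 s2 ℓ).1 ≤ s0 ∧ (Ψ.rowP s0 s1 s2 ℓ).2.1 ≤ s1 ∧ (Ψ.rowP s0 s1 s2 ℓ).2.2 ≤ s2 ∧
      (Ψ.colP s0 s1 s2 ℓ).1 ≤ 2 - s0 ∧ (Ψ.colP s0 s1 s2 ℓ).2.1 ≤ 2 - s1 ∧ (Ψ.colP s0 s1 s2 ℓ).2.2 ≤ 2 - s2)
/-- VALIDITY of a certificate for the class L (a Boolean the class files evaluate in the kernel). -/
def valid (L : List (ℤ × ℕ × ℕ × ℕ)) : Bool := Ψ.validF L && Ψ.validT && Ψ.validP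

variable {Ψ} {L : List (ℤ × ℕ × ℕ × ℕ)}

/-- soundness of (F). -/
theorem factor_eq (h : Ψ.valid L = true) {s0 s1 s2 a b e a' b' e' : ℕ} (h0 : s0 < 3) (h1 : s1 < 3) (h2 : s2 < 3)
    (ha : a < s0 + 1) (hb : b < s1 + 1) (he : e < s2 + 1) (ha' : a' < 3 - s0) (hb' : b' < 3 - s1) (he' : e' < 3 - s2) :
    Z8.rsum (Ψ.rs s0 s1 s2) (fun ℓ => Ψ.A s0 s1 s2 a b e ℓ * Ψ.B s0 s1 s2 ℓ a' b' e') = core L (a + a') (b + b') (e + e') := by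
  have hF : Ψ.validF L = true := by
    rw [valid, Bool.and_eq_true, Bool.and_eq_true] at h
    exact h.1.1
  simp only [validF, Z8.allLT_iff, decide_eq_true_eq] at hF
  exact hF s0 h0 s1 h1 s2 h2 a ha b hb e he a' ha' b' hb' e' he'

/-- soundness of (T), A part. -/
theorem A_upper_zero (h : Ψ.valid L = true) {s0 s1 s2 ℓ₀ ℓ : ℕ} (h0 : s0 < 3) (h1 : s1 < 3) (h2 : s2 < 3)
    (hℓ₀ : ℓ₀ < Ψ.rs s0 s1 s2) (hℓ : ℓ < Ψ.rs s0 s1 s2) (hlt : ℓ₀ < ℓ) :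
    Ψ.A s0 s1 s2 (Ψ.rowP s0 s1 s2 ℓ₀).1 (Ψ.rowP s0 s1 s2 ℓ₀).2.1 (Ψ.rowP s0 s1 s2 ℓ₀).2.2 ℓ = 0 := by
  have hT : Ψ.validT = true := by
    rw [valid, Bool.and_eq_true, Bool.and_eq_true] at h
    exact h.1.2
  simp only [validT, Z8.allLT_iff, Bool.or_eq_true, Bool.and_eq_true, decide_eq_true_eq] at hT
  rcases hT s0 h0 s1 h1 s2 h2 ℓ₀ hℓ₀ ℓ hℓ with hle | ⟨hA, -⟩
  · omega
  · exact hA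

/-- soundness of (T), B part. -/
theorem B_lower_zero (h : Ψ.valid L = true) {s0 s1 s2 ℓ₀ ℓ : ℕ} (h0 : s0 < 3) (h1 : s1 < 3) (h2 : s2 < 3)
    (hℓ₀ : ℓ₀ < Ψ.rs s0 s1 s2) (hℓ : ℓ < Ψ.rs s0 s1 s2) (hlt : ℓ₀ < ℓ) :
    Ψ.B s0 s1 s2 ℓ (Ψ.colP s0 s1 s2 ℓ₀).1 (Ψ.colP s0 s1 s2 ℓ₀).2.1 (Ψ.colP s0 s1 s2 ℓ₀).2.2 = 0 := by
  have hT : Ψ.validT = true := by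
    rw [valid, Bool.and_eq_true, Bool.and_eq_true] at h
    exact h.1.2
  simp only [validT, Z8.allLT_iff, Bool.or_eq_true, Bool.and_eq_true, decide_eq_true_eq] at hT
  rcases hT s0 h0 s1 h1 s2 h2 ℓ₀ hℓ₀ ℓ hℓ with hle | ⟨-, hB⟩
  · omega
  · exact hB

/-- soundness of (P). -/
theorem pivots (h : Ψ.valid L = true) {s0 s1 s2 ℓ : ℕ} (h0 : s0 < 3) (h1 : s1 < 3) (h2 : s2 < 3) (hℓ : ℓ < Ψ.rs s0 s1 s2) :
    (Ψ.A s0 s1 s2 (Ψ.rowP s0 s1 s2 ℓ).1 (Ψ.rowP s0 s1 s2 ℓ).2.1 (Ψ.rowP s0 s1 s2 ℓ).2.2 ℓ).isPosConst = true ∧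
    (Ψ.B s0 s1 s2 ℓ (Ψ.colP s0 s1 s2 ℓ).1 (Ψ.colP s0 s1 s2 ℓ).2.1 (Ψ.colP s0 s1 s2 ℓ).2.2 * Ψ.w s0 s1 s2 ℓ).isPosConst = true ∧
    ((Ψ.rowP s0 s1 s2 ℓ).1 ≤ s0 ∧ (Ψ.rowP s0 s1 s2 ℓ).2.1 ≤ s1 ∧ (Ψ.rowP s0 s1 s2 ℓ).2.2 ≤ s2 ∧
      (Ψ.colP s0 s1 s2 ℓ).1 ≤ 2 - s0 ∧ (Ψ.colP s0 s1 s2 ℓ).2.1 ≤ 2 - s1 ∧ (Ψ.colP s0 s1 s2 ℓ).2.2 ≤ 2 - s2) := by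
  have hP : Ψ.validP = true := by
    rw [valid, Bool.and_eq_true, Bool.and_eq_true] at h
    exact h.2
  simp only [validP, Z8.allLT_iff, Bool.and_eq_true, decide_eq_true_eq] at hP
  obtain ⟨⟨hA, hB⟩, hbox⟩ := hP s0 h0 s1 h1 s2 h2 ℓ hℓ
  exact ⟨hA, hB, hbox⟩

end CoreCert

/-! ## Modes -/

/-- r_{shape k} for a type k of the fourfold (`HodgeLocusCensusPlaneRank.sig*`; the shape of a type is its signature) … -/
abbrev rs4 (Ψ : CoreCert) (k : Fin 6) : ℕ := Ψ.rs (PlaneRank.sig0 k) (PlaneRank.sig1 k) (PlaneRank.sig2 k)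
/-- … of the sixfold (`HodgeLocusCensusPlaneRank6.sig*`; the shape is the head (σ₀,σ₁,σ₂) of the signature) … -/
abbrev rs6 (Ψ : CoreCert) (k : Fin 19) : ℕ := Ψ.rs (PlaneRank6.sig0 k) (PlaneRank6.sig1 k) (PlaneRank6.sig2 k)
/-- … and of the eightfold (`HodgeLocusCensusPlaneRank8.sig*`). -/
abbrev rs8 (Ψ : CoreCert) (k : Fin 45) : ℕ := Ψ.rs (PlaneRank8.sig0 k) (PlaneRank8.sig1 k) (PlaneRank8.sig2 k)

/-! ### re-indexing the modes of one type -/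

/-- The modes of a class on X⁴_n are enumerated type-major: the modes of type k are `off k ≤ m < off k + rs k` (`H1`, `H3`, within range by `H2`),
with ℓ = m − off k. A sum over all modes of a function supported on the modes of type k is the sum over ℓ < rs k. -/
theorem sum_modes {β : Type*} [AddCommMonoid β] {r T : ℕ} (modeK : Fin r → Fin T) (off rs : Fin T → ℕ)
    (H1 : ∀ m : Fin r, off (modeK m) ≤ m.1 ∧ m.1 < off (modeK m) + rs (modeK m))
    (H2 : ∀ k : Fin T, off k + rs k ≤ r)
    (H3 : ∀ m : Fin r, ∀ k : Fin T, off k ≤ m.1 → m.1 < off k + rs k → modeK m = k) (k : Fin T) (g : ℕ → β) :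
    ∑ m : Fin r, (if modeK m = k then g (m.1 - off k) else 0) = ∑ ℓ ∈ Finset.range (rs k), g ℓ := by
  rw [← Finset.sum_filter]
  refine Finset.sum_bij' (fun m _ => m.1 - off k)
    (fun ℓ hℓ => ⟨off k + ℓ, by have := H2 k; have := Finset.mem_range.mp hℓ; omega⟩) ?_ ?_ ?_ ?_ ?_
  · intro m hm
    obtain ⟨-, hk⟩ := Finset.mem_filter.mp hm
    have := H1 m
    rw [hk] at this
    exact Finset.mem_range.mpr (by omega)
  · intro ℓ hℓ
    have hℓ' := Finset.mem_range.mp hℓ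
    exact Finset.mem_filter.mpr ⟨Finset.mem_univ _, H3 _ k (by simp) (by simp; omega)⟩
  · intro m hm
    obtain ⟨-, hk⟩ := Finset.mem_filter.mp hm
    have := H1 m
    rw [hk] at this
    exact Fin.ext (by simp; omega)
  · intro ℓ hℓ
    simp
  · intro m hm
    rfl

/-- within one type the enumeration is increasing in ℓ. -/
theorem modeL_lt_of_lt {r T : ℕ} (modeK : Fin r → Fin T) (off rs : Fin T → ℕ)
    (H1 : ∀ m : Fin r, off (modeK m) ≤ m.1 ∧ m.1 < off (modeK m) + rs (modeK m)) {m m' : Fin r} (hlt : m < m')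
    (hk : modeK m' = modeK m) : m.1 - off (modeK m) < m'.1 - off (modeK m) ∧ m'.1 - off (modeK m) < rs (modeK m) := by
  have h := H1 m
  have h' := H1 m'
  rw [hk] at h'
  have : m.1 < m'.1 := hlt
  omega

end Summit.HodgeConjecture.HodgeConjecture.HodgeLocus.Census.PlaneSum
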